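import Mathlib
import Literature.Analysis.FluidPDE.VectorCalculus

/-!
# Directional derivative of the regularised Biot–Savart field of a proper filament

Tools stub `stub_biotSavartDirectionalDeriv` of line `Sketch` (crux `SkeletonEquilibrium`, thesis
`FilamentSkeletonRss`). For the Rosenhead-regularised Biot–Savart law with core parameter `e ≠ 0`
and a `C¹` curve `X : ℝ → ℝ³` with `‖X′‖ ≤ 1` and linear growth `c |u| − C ≤ ‖X u‖` (`c > 0`),
the induced field `F(y) = ∫ K₃(y − X u) • X′(u) × (y − X u) du`, `K₃(z) = ((‖z‖² + e²)^{3/2})⁻¹`,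
has at every point `y` and in every direction `v` the EXPLICIT directional derivative
`d/ds F(y + s v)|_{s=0} = ∫ [−3 ⟨y − X u, v⟩ K₅(y − X u) • X′(u) × (y − X u) + K₃(y − X u) • X′(u) × v] du`,
`K₅(z) = ((‖z‖² + e²)^{5/2})⁻¹`, and the derivative integrand is Bochner integrable.

Proof: one-dimensional differentiation under the integral sign (Mathlib's
`hasDerivAt_integral_of_dominated_loc_of_deriv_le`) for the family `s ↦ K₃(y + s v − X u) •
X′(u) × (y + s v − X u)` on the ball `|s| < 1`. The `s`-derivative is computed by the chain rule
through `‖·‖²` and `rpow` (kernel) and linearity of `a × ·` (product rule `HasDerivAt.smul`); with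
`w = y + s v − X u`, `σ = ‖w‖² + e²`, its norm is `≤ 3 ‖v‖ σ^{−5/2} ‖w‖² + σ^{−3/2} ‖v‖ ≤
4 ‖v‖ σ^{−3/2} ≤ 4 ‖v‖ |e|⁻¹ σ⁻¹`, and on the ball `‖w‖ ≥ c |u| − D`, `D = |C| + ‖y‖ + ‖v‖ + 1`,
whence `1 + u² ≤ M σ` with `M = (4e² + c² + 4D²)/(c² e²)`: both the integrand (`≤ σ⁻¹`) and its
derivative are dominated by constant multiples of the integrable `(1 + u²)⁻¹`
(`integrable_inv_one_add_sq`). Measurability is continuity in `u`. The kernel-calculus lemmas are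
adapted from the sibling stub file `…BiotSavartDifferentiable.lean` (p132747).
-/

noncomputable section

open MeasureTheory Filter Topology
open Literature.Analysis.FluidPDE

namespace Summit.NavierStokesRegularity.NavierStokesRegularity.Theorems.SkeletonEquilibrium.Sketch
set_option linter.dupNamespace false

/-- `‖a × b‖ ≤ ‖a‖ ‖b‖` (from `norm_cross`, `sin ≤ 1`). [folklore] -/
private theorem bsdd_norm_cross_le (a b : EuclideanSpace ℝ (Fin 3)) :
    ‖cross a b‖ ≤ ‖a‖ * ‖b‖ := by
  rw [norm_cross]
  exact mul_le_of_le_one_right (by positivity) (Real.sin_le_one _)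

/-- The affine line `s ↦ y + s • v − b` has velocity `v`. [folklore] -/
private theorem bsdd_hasDerivAt_line (y v b : EuclideanSpace ℝ (Fin 3)) (s : ℝ) :
    HasDerivAt (fun s : ℝ => y + s • v - b) v s :=
  ((((hasDerivAt_id' (x := s)).smul_const v).const_add y).sub_const b).congr_deriv (one_smul _ _)

/-- `s ↦ a × (y + s • v − b)` has derivative `a × v` (linearity of `a × ·`). [folklore] -/
private theorem bsdd_hasDerivAt_cross (a y v b : EuclideanSpace ℝ (Fin 3)) (s : ℝ) :
    HasDerivAt (fun s : ℝ => cross a (y + s • v - b)) (cross a v) s := by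
  have h := (crossCLM a).hasFDerivAt.comp_hasDerivAt s (bsdd_hasDerivAt_line y v b s)
  simpa [Function.comp_def] using h

/-- The regularised kernel along the line, `s ↦ ((‖y + s v − b‖² + e²)^{3/2})⁻¹` (`e ≠ 0`), has
derivative `−3 ⟨y + s v − b, v⟩ ((‖y + s v − b‖² + e²)^{5/2})⁻¹`. [folklore] -/
private theorem bsdd_hasDerivAt_kernel {e : ℝ} (he : e ≠ 0) (y v b : EuclideanSpace ℝ (Fin 3))
    (s : ℝ) :
    HasDerivAt (fun s : ℝ => ((‖y + s • v - b‖ ^ 2 + e ^ 2) ^ (3 / 2 : ℝ))⁻¹)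
      (-3 * inner ℝ (y + s • v - b) v * ((‖y + s • v - b‖ ^ 2 + e ^ 2) ^ (5 / 2 : ℝ))⁻¹) s := by
  have hpos : ∀ z : EuclideanSpace ℝ (Fin 3), 0 < ‖z‖ ^ 2 + e ^ 2 := fun z => by positivity
  have h1 : HasDerivAt (fun s : ℝ => ‖y + s • v - b‖ ^ 2 + e ^ 2)
      (2 * inner ℝ (y + s • v - b) v) s :=
    (bsdd_hasDerivAt_line y v b s).norm_sq.add_const _
  have h2 := h1.rpow_const (p := -(3 / 2)) (Or.inl (hpos _).ne')
  have hfun : (fun s : ℝ => ((‖y + s • v - b‖ ^ 2 + e ^ 2) ^ (3 / 2 : ℝ))⁻¹)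
      = fun s => (‖y + s • v - b‖ ^ 2 + e ^ 2) ^ (-(3 / 2) : ℝ) := by
    funext s
    rw [Real.rpow_neg (hpos _).le]
  rw [hfun]
  refine h2.congr_deriv ?_
  rw [show (-(3 / 2) : ℝ) - 1 = -(5 / 2) by norm_num, Real.rpow_neg (hpos _).le]
  ring

/-- Product rule along the line: the `s`-derivative of the regularised Biot–Savart integrand
`K₃(y + s v − b) • a × (y + s v − b)` is
`(−3 ⟨y + s v − b, v⟩ K₅) • a × (y + s v − b) + K₃ • a × v`. [folklore] -/
private theorem bsdd_hasDerivAt_integrand {e : ℝ} (he : e ≠ 0)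
    (a y v b : EuclideanSpace ℝ (Fin 3)) (s : ℝ) :
    HasDerivAt (fun s : ℝ =>
        ((‖y + s • v - b‖ ^ 2 + e ^ 2) ^ (3 / 2 : ℝ))⁻¹ • cross a (y + s • v - b))
      ((-3 * inner ℝ (y + s • v - b) v * ((‖y + s • v - b‖ ^ 2 + e ^ 2) ^ (5 / 2 : ℝ))⁻¹) •
          cross a (y + s • v - b) +
        ((‖y + s • v - b‖ ^ 2 + e ^ 2) ^ (3 / 2 : ℝ))⁻¹ • cross a v) s :=
  ((bsdd_hasDerivAt_kernel he y v b s).smul (bsdd_hasDerivAt_cross a y v b s)).congr_deriv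
    (add_comm _ _)

/-- Scalar kernel estimate: `σ^{−3/2} ≤ |e|⁻¹ σ⁻¹` for `σ ≥ e² > 0`. [folklore] -/
private theorem bsdd_rpow_neg_three_halves_le {e σ : ℝ} (he : e ≠ 0) (hσ : e ^ 2 ≤ σ) :
    σ ^ (-(3 / 2) : ℝ) ≤ |e|⁻¹ * σ⁻¹ := by
  have he2 : 0 < e ^ 2 := by positivity
  have hσ0 : 0 < σ := he2.trans_le hσ
  rw [show (-(3 / 2) : ℝ) = -(1 / 2) + -1 by norm_num, Real.rpow_add hσ0, Real.rpow_neg_one]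
  refine mul_le_mul_of_nonneg_right ?_ (inv_nonneg.2 hσ0.le)
  calc σ ^ (-(1 / 2) : ℝ) ≤ (e ^ 2) ^ (-(1 / 2) : ℝ) :=
        Real.rpow_le_rpow_of_nonpos he2 hσ (by norm_num)
    _ = |e|⁻¹ := by
        rw [Real.rpow_neg he2.le, ← Real.sqrt_eq_rpow, Real.sqrt_sq_eq_abs]

/-- Pointwise bound on the integrand: `‖K₃(w) • a × w‖ ≤ (‖w‖² + e²)⁻¹` for `‖a‖ ≤ 1`
(as `‖w‖ ≤ (‖w‖² + e²)^{1/2}`). [folklore] -/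
private theorem bsdd_norm_integrand_le {e : ℝ} (he : e ≠ 0) (a w : EuclideanSpace ℝ (Fin 3))
    (ha : ‖a‖ ≤ 1) :
    ‖((‖w‖ ^ 2 + e ^ 2) ^ (3 / 2 : ℝ))⁻¹ • cross a w‖ ≤ (‖w‖ ^ 2 + e ^ 2)⁻¹ := by
  have hσ0 : 0 < ‖w‖ ^ 2 + e ^ 2 := by positivity
  have hw : ‖w‖ ≤ (‖w‖ ^ 2 + e ^ 2) ^ (1 / 2 : ℝ) := by
    rw [← Real.sqrt_eq_rpow]
    exact Real.le_sqrt_of_sq_le (by nlinarith [sq_nonneg e])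
  rw [norm_smul, norm_inv, Real.norm_of_nonneg (Real.rpow_nonneg hσ0.le _),
    ← Real.rpow_neg hσ0.le]
  calc (‖w‖ ^ 2 + e ^ 2) ^ (-(3 / 2) : ℝ) * ‖cross a w‖
      ≤ (‖w‖ ^ 2 + e ^ 2) ^ (-(3 / 2) : ℝ) * (‖w‖ ^ 2 + e ^ 2) ^ (1 / 2 : ℝ) := by
        refine mul_le_mul_of_nonneg_left ?_ (Real.rpow_nonneg hσ0.le _)
        calc ‖cross a w‖ ≤ ‖a‖ * ‖w‖ := bsdd_norm_cross_le a w
          _ ≤ 1 * ‖w‖ := mul_le_mul_of_nonneg_right ha (norm_nonneg _)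
          _ ≤ _ := by rw [one_mul]; exact hw
    _ = (‖w‖ ^ 2 + e ^ 2)⁻¹ := by
        rw [← Real.rpow_add hσ0, show (-(3 / 2) : ℝ) + 1 / 2 = -1 by norm_num, Real.rpow_neg_one]

/-- Pointwise bound on the `s`-derivative of the integrand:
`‖(−3 ⟨w, v⟩ K₅(w)) • a × w + K₃(w) • a × v‖ ≤ 4 |e|⁻¹ (‖w‖² + e²)⁻¹ ‖v‖` for `‖a‖ ≤ 1`
(`|⟨w, v⟩| ‖a × w‖ ≤ ‖v‖ ‖w‖²  ≤ ‖v‖ σ`, `σ = ‖w‖² + e²`). [folklore] -/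
private theorem bsdd_norm_deriv_integrand_le {e : ℝ} (he : e ≠ 0)
    (a w v : EuclideanSpace ℝ (Fin 3)) (ha : ‖a‖ ≤ 1) :
    ‖(-3 * inner ℝ w v * ((‖w‖ ^ 2 + e ^ 2) ^ (5 / 2 : ℝ))⁻¹) • cross a w +
        ((‖w‖ ^ 2 + e ^ 2) ^ (3 / 2 : ℝ))⁻¹ • cross a v‖
      ≤ 4 * |e|⁻¹ * (‖w‖ ^ 2 + e ^ 2)⁻¹ * ‖v‖ := by
  set σ := ‖w‖ ^ 2 + e ^ 2 with hσ_def
  have hσ0 : 0 < σ := by positivity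
  have heσ : e ^ 2 ≤ σ := le_add_of_nonneg_left (sq_nonneg _)
  have hwσ : ‖w‖ ^ 2 ≤ σ := le_add_of_nonneg_right (sq_nonneg e)
  have hk3 : (σ ^ (3 / 2 : ℝ))⁻¹ = σ ^ (-(3 / 2) : ℝ) := (Real.rpow_neg hσ0.le _).symm
  have hk5 : (σ ^ (5 / 2 : ℝ))⁻¹ = σ ^ (-(5 / 2) : ℝ) := (Real.rpow_neg hσ0.le _).symm
  have hcw : ‖cross a w‖ ≤ ‖w‖ :=
    (bsdd_norm_cross_le a w).trans (mul_le_of_le_one_left (norm_nonneg _) ha)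
  have hcv : ‖cross a v‖ ≤ ‖v‖ :=
    (bsdd_norm_cross_le a v).trans (mul_le_of_le_one_left (norm_nonneg _) ha)
  have hi : |inner ℝ w v| ≤ ‖w‖ * ‖v‖ := abs_real_inner_le_norm w v
  have h1 : ‖(-3 * inner ℝ w v * (σ ^ (5 / 2 : ℝ))⁻¹) • cross a w‖
      ≤ 3 * σ ^ (-(3 / 2) : ℝ) * ‖v‖ := by
    rw [norm_smul, hk5, Real.norm_eq_abs, abs_mul, abs_mul, abs_neg,
      abs_of_pos (by norm_num : (0 : ℝ) < 3), abs_of_nonneg (Real.rpow_nonneg hσ0.le _)]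
    calc 3 * |inner ℝ w v| * σ ^ (-(5 / 2) : ℝ) * ‖cross a w‖
        ≤ 3 * (‖w‖ * ‖v‖) * σ ^ (-(5 / 2) : ℝ) * ‖w‖ :=
          mul_le_mul (by gcongr) hcw (norm_nonneg _) (by positivity)
      _ = 3 * (σ ^ (-(5 / 2) : ℝ) * ‖w‖ ^ 2) * ‖v‖ := by ring
      _ ≤ 3 * (σ ^ (-(5 / 2) : ℝ) * σ) * ‖v‖ := by gcongr
      _ = 3 * σ ^ (-(3 / 2) : ℝ) * ‖v‖ := by
          rw [show (-(3 / 2) : ℝ) = -(5 / 2) + 1 by norm_num, Real.rpow_add_one hσ0.ne']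
  have h2 : ‖(σ ^ (3 / 2 : ℝ))⁻¹ • cross a v‖ ≤ σ ^ (-(3 / 2) : ℝ) * ‖v‖ := by
    rw [norm_smul, hk3, Real.norm_of_nonneg (Real.rpow_nonneg hσ0.le _)]
    exact mul_le_mul_of_nonneg_left hcv (Real.rpow_nonneg hσ0.le _)
  calc _ ≤ _ := norm_add_le _ _
    _ ≤ 3 * σ ^ (-(3 / 2) : ℝ) * ‖v‖ + σ ^ (-(3 / 2) : ℝ) * ‖v‖ := add_le_add h1 h2
    _ = 4 * σ ^ (-(3 / 2) : ℝ) * ‖v‖ := by ring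
    _ ≤ 4 * (|e|⁻¹ * σ⁻¹) * ‖v‖ := by
        gcongr
        exact bsdd_rpow_neg_three_halves_le he heσ
    _ = 4 * |e|⁻¹ * σ⁻¹ * ‖v‖ := by ring

/-- Far-field growth: if `c t − D ≤ r` (`c, D > 0`, `r, t ≥ 0`, `e ≠ 0`) then
`1 + t² ≤ M (r² + e²)` with `M = (4e² + c² + 4D²)/(c² e²)` (from `c² t² ≤ 4 r² + 4 D²`).
[folklore] -/
private theorem bsdd_one_add_sq_le {c D r t e : ℝ} (hc : 0 < c) (hD : 0 < D) (hr : 0 ≤ r)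
    (ht : 0 ≤ t) (he : e ≠ 0) (h : c * t - D ≤ r) :
    1 + t ^ 2 ≤ (4 * e ^ 2 + c ^ 2 + 4 * D ^ 2) / (c ^ 2 * e ^ 2) * (r ^ 2 + e ^ 2) := by
  have key : c ^ 2 * t ^ 2 ≤ 4 * r ^ 2 + 4 * D ^ 2 := by
    rcases le_or_gt (c * t) D with h1 | h1
    · have hct : 0 ≤ c * t := mul_nonneg hc.le ht
      nlinarith [mul_le_mul h1 h1 hct hD.le, sq_nonneg r]
    · have hctD : 0 ≤ c * t - D := by linarith
      nlinarith [mul_le_mul h h hctD hr, sq_nonneg (3 * c * t - 4 * D), sq_nonneg D]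
  have he2 : 0 < e ^ 2 := by positivity
  have hc2 : 0 < c ^ 2 := by positivity
  rw [div_mul_eq_mul_div, le_div_iff₀ (by positivity)]
  nlinarith [mul_le_mul_of_nonneg_left key he2.le, mul_nonneg (sq_nonneg r) he2.le,
    mul_nonneg hc2.le (sq_nonneg r), mul_nonneg (sq_nonneg D) (sq_nonneg r), sq_nonneg (e ^ 2)]

/-- Uniform domination near `y`: for `‖z − y‖ ≤ R` (`R ≥ 0`),
`(‖z − X u‖² + e²)⁻¹ ≤ M (1 + u²)⁻¹` with `M = (4e² + c² + 4D²)/(c² e²)`,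
`D = |C| + ‖y‖ + R + 1`. [folklore] -/
private theorem bsdd_inv_le {e c C R : ℝ} {X : ℝ → EuclideanSpace ℝ (Fin 3)}
    (he : e ≠ 0) (hc : 0 < c) (hXg : ∀ u, c * |u| - C ≤ ‖X u‖) (hR : 0 ≤ R)
    (y : EuclideanSpace ℝ (Fin 3)) {z : EuclideanSpace ℝ (Fin 3)} (hz : ‖z - y‖ ≤ R) (u : ℝ) :
    (‖z - X u‖ ^ 2 + e ^ 2)⁻¹ ≤
      (4 * e ^ 2 + c ^ 2 + 4 * (|C| + ‖y‖ + R + 1) ^ 2) / (c ^ 2 * e ^ 2) * (1 + u ^ 2)⁻¹ := by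
  have hD : 0 < |C| + ‖y‖ + R + 1 := by positivity
  have hr : c * |u| - (|C| + ‖y‖ + R + 1) ≤ ‖z - X u‖ := by
    have h1 := norm_sub_norm_le (X u) z
    have h2 := norm_le_norm_add_norm_sub' z y
    have h3 := hXg u
    have h4 := le_abs_self C
    rw [norm_sub_rev] at h1
    linarith
  have key := bsdd_one_add_sq_le hc hD (norm_nonneg _) (abs_nonneg u) he hr
  rw [sq_abs] at key
  have hσ0 : 0 < ‖z - X u‖ ^ 2 + e ^ 2 := by positivity
  have h1u : 0 < 1 + u ^ 2 := by positivity
  rw [← div_eq_mul_inv, le_div_iff₀ h1u, inv_mul_le_iff₀ hσ0]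
  linarith [mul_comm ((4 * e ^ 2 + c ^ 2 + 4 * (|C| + ‖y‖ + R + 1) ^ 2) / (c ^ 2 * e ^ 2))
    (‖z - X u‖ ^ 2 + e ^ 2)]

/-- Continuity in `u` of the regularised kernels `u ↦ ((‖z − X u‖² + e²)^p)⁻¹` (`e ≠ 0`).
[folklore] -/
private theorem bsdd_continuous_kernel {e : ℝ} (he : e ≠ 0)
    {X : ℝ → EuclideanSpace ℝ (Fin 3)} (hXc : Continuous X) (z : EuclideanSpace ℝ (Fin 3))
    (p : ℝ) : Continuous (fun u : ℝ => ((‖z - X u‖ ^ 2 + e ^ 2) ^ p)⁻¹) := by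
  have hpos : ∀ u, (0 : ℝ) < ‖z - X u‖ ^ 2 + e ^ 2 := fun u => by positivity
  exact ((((continuous_const.sub hXc).norm.pow 2).add continuous_const).rpow_const
    fun u => Or.inl (hpos u).ne').inv₀ fun u => (Real.rpow_pos_of_pos (hpos u) _).ne'

/-- Continuity in `u` of the integrand `K₃(z − X u) • X′(u) × (z − X u)` at a fixed point `z`.
[folklore] -/
private theorem bsdd_continuous_integrand {e : ℝ} (he : e ≠ 0)
    {X : ℝ → EuclideanSpace ℝ (Fin 3)} (hX : ContDiff ℝ 1 X) (z : EuclideanSpace ℝ (Fin 3)) :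
    Continuous (fun u : ℝ =>
      ((‖z - X u‖ ^ 2 + e ^ 2) ^ (3 / 2 : ℝ))⁻¹ • cross (deriv X u) (z - X u)) := by
  have hXc : Continuous X := hX.continuous
  have hX'c : Continuous (deriv X) := hX.continuous_deriv le_rfl
  have hcr : Continuous (fun u => cross (deriv X u) (z - X u)) :=
    (crossCLM.continuous.comp hX'c).clm_apply (continuous_const.sub hXc)
  exact (bsdd_continuous_kernel he hXc z _).smul hcr

/-- Continuity in `u` of the derivative integrand
`(−3 ⟨z − X u, v⟩ K₅) • X′(u) × (z − X u) + K₃ • X′(u) × v` at a fixed point `z`. [folklore] -/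
private theorem bsdd_continuous_deriv_integrand {e : ℝ} (he : e ≠ 0)
    {X : ℝ → EuclideanSpace ℝ (Fin 3)} (hX : ContDiff ℝ 1 X) (z v : EuclideanSpace ℝ (Fin 3)) :
    Continuous (fun u : ℝ =>
      (-3 * inner ℝ (z - X u) v * ((‖z - X u‖ ^ 2 + e ^ 2) ^ (5 / 2 : ℝ))⁻¹) •
          cross (deriv X u) (z - X u) +
        ((‖z - X u‖ ^ 2 + e ^ 2) ^ (3 / 2 : ℝ))⁻¹ • cross (deriv X u) v) := by
  have hXc : Continuous X := hX.continuous
  have hX'c : Continuous (deriv X) := hX.continuous_deriv le_rfl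
  have hv : Continuous (fun u : ℝ => z - X u) := continuous_const.sub hXc
  have hcr : Continuous (fun u => cross (deriv X u) (z - X u)) :=
    (crossCLM.continuous.comp hX'c).clm_apply hv
  have hcv : Continuous (fun u => cross (deriv X u) v) :=
    (crossCLM.continuous.comp hX'c).clm_apply continuous_const
  exact (((continuous_const.mul (hv.inner continuous_const)).mul
    (bsdd_continuous_kernel he hXc z _)).smul hcr).add ((bsdd_continuous_kernel he hXc z _).smul hcv)

/-- Differentiation under the integral sign along the line `s ↦ y + s • v` at `s = 0`
(Mathlib's `hasDerivAt_integral_of_dominated_loc_of_deriv_le` on the ball `|s| < 1`, dominated by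
a multiple of `(1 + u²)⁻¹`); the point is written `y + 0 • v`. [folklore] -/
private theorem bsdd_key {e c C : ℝ} {X : ℝ → EuclideanSpace ℝ (Fin 3)}
    (he : e ≠ 0) (hc : 0 < c) (hX : ContDiff ℝ 1 X) (hX1 : ∀ u, ‖deriv X u‖ ≤ 1)
    (hXg : ∀ u, c * |u| - C ≤ ‖X u‖) (y v : EuclideanSpace ℝ (Fin 3)) :
    Integrable (fun u : ℝ =>
        (-3 * inner ℝ (y + (0 : ℝ) • v - X u) v *
              ((‖y + (0 : ℝ) • v - X u‖ ^ 2 + e ^ 2) ^ (5 / 2 : ℝ))⁻¹) •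
            cross (deriv X u) (y + (0 : ℝ) • v - X u) +
          ((‖y + (0 : ℝ) • v - X u‖ ^ 2 + e ^ 2) ^ (3 / 2 : ℝ))⁻¹ • cross (deriv X u) v) ∧
      HasDerivAt (fun s : ℝ => ∫ u : ℝ,
          ((‖y + s • v - X u‖ ^ 2 + e ^ 2) ^ (3 / 2 : ℝ))⁻¹ • cross (deriv X u) (y + s • v - X u))
        (∫ u : ℝ,
          (-3 * inner ℝ (y + (0 : ℝ) • v - X u) v *
                ((‖y + (0 : ℝ) • v - X u‖ ^ 2 + e ^ 2) ^ (5 / 2 : ℝ))⁻¹) •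
              cross (deriv X u) (y + (0 : ℝ) • v - X u) +
            ((‖y + (0 : ℝ) • v - X u‖ ^ 2 + e ^ 2) ^ (3 / 2 : ℝ))⁻¹ • cross (deriv X u) v) 0 := by
  set M : ℝ := (4 * e ^ 2 + c ^ 2 + 4 * (|C| + ‖y‖ + ‖v‖ + 1) ^ 2) / (c ^ 2 * e ^ 2) with hM_def
  have hdom : ∀ u : ℝ, ∀ s ∈ Metric.ball (0 : ℝ) 1,
      (‖y + s • v - X u‖ ^ 2 + e ^ 2)⁻¹ ≤ M * (1 + u ^ 2)⁻¹ := by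
    intro u s hs
    rw [Metric.mem_ball, dist_zero_right, Real.norm_eq_abs] at hs
    refine bsdd_inv_le he hc hXg (norm_nonneg v) y ?_ u
    rw [add_sub_cancel_left, norm_smul, Real.norm_eq_abs]
    exact mul_le_of_le_one_left (norm_nonneg v) hs.le
  refine hasDerivAt_integral_of_dominated_loc_of_deriv_le (𝕜 := ℝ) (μ := volume) (x₀ := (0 : ℝ))
    (F := fun (s : ℝ) (u : ℝ) =>
      ((‖y + s • v - X u‖ ^ 2 + e ^ 2) ^ (3 / 2 : ℝ))⁻¹ • cross (deriv X u) (y + s • v - X u))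
    (F' := fun (s : ℝ) (u : ℝ) =>
      (-3 * inner ℝ (y + s • v - X u) v * ((‖y + s • v - X u‖ ^ 2 + e ^ 2) ^ (5 / 2 : ℝ))⁻¹) •
          cross (deriv X u) (y + s • v - X u) +
        ((‖y + s • v - X u‖ ^ 2 + e ^ 2) ^ (3 / 2 : ℝ))⁻¹ • cross (deriv X u) v)
    (bound := fun u => 4 * |e|⁻¹ * (M * (1 + u ^ 2)⁻¹) * ‖v‖)
    (Metric.ball_mem_nhds (0 : ℝ) one_pos) ?_ ?_ ?_ ?_ ?_ ?_
  · exact Eventually.of_forall fun s =>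
      (bsdd_continuous_integrand he hX (y + s • v)).aestronglyMeasurable
  · refine (integrable_inv_one_add_sq.const_mul M).mono'
      (bsdd_continuous_integrand he hX _).aestronglyMeasurable (Eventually.of_forall fun u => ?_)
    exact (bsdd_norm_integrand_le he _ _ (hX1 u)).trans (hdom u 0 (Metric.mem_ball_self one_pos))
  · exact (bsdd_continuous_deriv_integrand he hX _ v).aestronglyMeasurable
  · refine Eventually.of_forall fun u s hs => ?_
    calc _ ≤ 4 * |e|⁻¹ * (‖y + s • v - X u‖ ^ 2 + e ^ 2)⁻¹ * ‖v‖ :=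
          bsdd_norm_deriv_integrand_le he _ _ _ (hX1 u)
      _ ≤ 4 * |e|⁻¹ * (M * (1 + u ^ 2)⁻¹) * ‖v‖ := by
          gcongr
          exact hdom u s hs
  · exact ((integrable_inv_one_add_sq.const_mul M).const_mul _).mul_const _
  · exact Eventually.of_forall fun u s _ => bsdd_hasDerivAt_integrand he (deriv X u) y v (X u) s

/-- **Tools stub** (`stub_biotSavartDirectionalDeriv`): for `e ≠ 0`, `c > 0` and a `C¹` curve
`X : ℝ → ℝ³` with `‖X′‖ ≤ 1` and linear growth `c |u| − C ≤ ‖X u‖`, the Rosenhead-regularised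
Biot–Savart field `F(y) = ∫ ((‖y − X u‖² + e²)^{3/2})⁻¹ • X′(u) × (y − X u) du` has, at every
point `y` and in every direction `v`, the directional derivative
`d/ds F(y + s v)|_{s=0} = ∫ [(−3 ⟨y − X u, v⟩ ((‖y − X u‖² + e²)^{5/2})⁻¹) • X′(u) × (y − X u)
  + ((‖y − X u‖² + e²)^{3/2})⁻¹ • X′(u) × v] du`,
with Bochner-integrable integrand (differentiation under the integral sign, dominated on
`|s| < 1` by a multiple of `(1 + u²)⁻¹`). [folklore] -/
theorem stub_biotSavartDirectionalDeriv :
    ∀ (e c C : ℝ) (X : ℝ → EuclideanSpace ℝ (Fin 3)),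
      e ≠ 0 → 0 < c → ContDiff ℝ 1 X → (∀ u, ‖deriv X u‖ ≤ 1) → (∀ u, c * |u| - C ≤ ‖X u‖) →
      ∀ (y v : EuclideanSpace ℝ (Fin 3)),
        Integrable (fun u : ℝ =>
          (-3 * inner ℝ (y - X u) v * ((‖y - X u‖ ^ 2 + e ^ 2) ^ (5 / 2 : ℝ))⁻¹) • cross (deriv X u) (y - X u)
            + ((‖y - X u‖ ^ 2 + e ^ 2) ^ (3 / 2 : ℝ))⁻¹ • cross (deriv X u) v) ∧
        HasDerivAt (fun s : ℝ => ∫ u : ℝ,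
            ((‖y + s • v - X u‖ ^ 2 + e ^ 2) ^ (3 / 2 : ℝ))⁻¹ • cross (deriv X u) (y + s • v - X u))
          (∫ u : ℝ,
            (-3 * inner ℝ (y - X u) v * ((‖y - X u‖ ^ 2 + e ^ 2) ^ (5 / 2 : ℝ))⁻¹) • cross (deriv X u) (y - X u)
              + ((‖y - X u‖ ^ 2 + e ^ 2) ^ (3 / 2 : ℝ))⁻¹ • cross (deriv X u) v) 0 := by
  intro e c C X he hc hX hX1 hXg y v
  simpa only [zero_smul, add_zero] using bsdd_key he hc hX hX1 hXg y v

end Summit.NavierStokesRegularity.NavierStokesRegularity.Theorems.SkeletonEquilibrium.Sketch
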